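import Literature.IUT.HodgeArakelov.LabelClassesOfCuspsCor24iiProofs
import Literature.IUT.HodgeArakelov.LabelClassesOfCuspsR3
import HarnessLib

/-!
# [IUTchII] Cor 2.4 (ii) (a), second intersectand "`D_t ⊆ Π^tp_{Ÿ̲_v}`": the `Y̲_v`-half PROVED, the residual ISOLATED as the
# splitting of the cusps in the double covering `Ÿ̲_v → Y̲_v`

S. Mochizuki, *Inter-universal Teichmüller theory II*, kurims manuscript (Dec. 2020), §2, Corollary 2.4 (ii) p. 70 l. 23–42
("(a) a decomposition group `D^δ_t := N_{Π^δ_v}(I^δ_t) ⊆ Π^δ_{v□̈}`", with p. 69 "`Π_{v□̈} := Π_{v□} ∩ Π^tp_{Ÿ̲_v}`"); Prop. 2.2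
p. 66 ("`Π_{v▶} ⊆ Π^tp_{Y_v} ∩ Π_v = Π^tp_{Y̲_v}`"); Def. 2.3 (iv) p. 68 ("`Π_{v•t} ⊆ Π_{v▶} ⊆ Π_v`"); Prop. 2.1 / Rmk. 2.1.1 (i)
p. 65 (the double covering `Ÿ̲_v → Y̲_v`, [IUTchI] Ex. 3.2 (ii)). [cite: Mochizuki2012, II Cor 2.4 (ii) p.70] (D-0012 claim key,
status disputed; elementary group theory over the landed typings; nothing of the series is asserted).

PROOF-ONLY companion (abc-iut cell, W6-TRANCHE-2 row d069 = cone node `IUTchII:Cor2.4(ii)`, seat abc-iut-w6-d069; sub-DAG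
`plan/L6/SUBDAG-IUTchII-Cor-24.md` row Cor-24.ii.r6) of `LabelClassesOfCuspsCor24iiProofs.lean` (abc-iut-w5-d184, p413817), which
splits the typed statement of record `Cor24_ii_iii' W C H` (abc-iut-L6-d1, p408486) into (a.1) "`D_t ⊆ Π_{v□}`" — PROVED there
modulo Cor. 2.4 (i) + (S) + (E) — and (a.2) "`D_t ⊆ Π^tp_{Ÿ̲_v}`" = the hypothesis `hYdd` of every landed closer
(`cor24_ii_iii'_of_inputs`, `…_of_agreements`, `…_of_levels_byName`, `…_of_graphTower_byName`, …).  No definition; landed files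
are not edited.

WHAT IS PROVED HERE.  (a.2) factors through the tower `Π^tp_{Ÿ̲_v} ⊆ Π^tp_{Y̲_v} ⊆ Π_v` (`TemperedCoverings.YddL ≤ YL`):
* `le_YL_of_cor24_family` — every ADMISSIBLE `Π_{v□}` (`Cor24_family`: `Π_{v▶}` or `Π_{v•t}`) lies in `Π^tp_{Y̲_v}` (Prop. 2.2 /
  Def. 2.3 (iv): `Ptri ≤ YL`, `Pbt t ≤ Ptri`, BY NAME);
* **`cuspDecomp_one_le_map_YL_of_cor24_i`** — the **`Y̲_v`-half of (a.2)**, "`D_t ⊆ Π^tp_{Y̲_v}`", PROVED for every `Π_{v□} ⊆ Π^tp_{Y̲_v}`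
  modulo exactly the inputs of (a.1) (Cor. 2.4 (i) for the cuspidal inertia groups in `Δ_{v□}`, (S), (E)): `D_t ⊆ Π_{v□} ⊆ Π^tp_{Y̲_v}`
  — the "`Gal(Y̲_v/X̲_v) ≅ l·ℤ` part" of the sub-DAG row r6;
* **`cor24_ii_iii'_iff_ysplit`** — EXACTNESS: under the same inputs the typed node statement `Cor24_ii_iii' W C H` is EQUIVALENT to
  the pure **`{±1}`-residual** (YS) "`D_t ∩ Π^tp_{Y̲_v} ⊆ Π^tp_{Ÿ̲_v}` for every cuspidal inertia `I_t ⊆ Δ_{v□}`" — the decomposition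
  groups of the cusps abutting `□` SPLIT in the degree-2 covering `Ÿ̲_v → Y̲_v` ([IUTchI] Ex. 3.2 (ii): `K_v` contains the relevant
  roots of `q_v`; [EtTh] §1: `Ÿ = Y₂` over `K₂ = K(√q)`), which no landed interface carries (`SemiGraphs.TemperedCurve.cuspDecomp`
  has `le_ker_of_mem_cuspDecomp : D ≤ Π^tp_Y` only; `EtaleTheta.ThetaSetting.GtpYN` has no cusp clause) — recorded as a
  GAP-LEDGER row by this seat, not smuggled;
* `cor24_ii_iii'_of_inputs_of_ysplit`, `cor24_ii_iii'_of_family_of_ysplit` — the assemblies with `hYdd` REPLACED by (YS).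
Nothing here takes a side on [IUTchIII] Cor. 3.12; typed ≠ discharged.
-/

namespace Literature.IUT.HodgeArakelov

universe u

variable {S : BadPlaceSetting.{u}} {P : TopGroup.{u}} {T : TemperedCoverings S P}

section Family

variable {D : EtaleThetaData S.toThetaSetting P} (Dec : SubgraphDecomposition S T D) {W : PlusMinusTower T}
  {C : CuspidalInertiaData W} {L : LabCuspStructure C} (Ld : LabelledDecomposition Dec L) {H : Subgroup P}

/-- **IUTchII:Prop2.2 / Def2.3(iv)** (kurims p. 66 "`Π_{v▶} ⊆ Π^tp_{Y_v} ∩ Π_v = Π^tp_{Y̲_v}`", p. 68 "`Π_{v•t} ⊆ Π_{v▶}`"): every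
admissible `Π_{v□}` of Cor. 2.4 lies in `Π^tp_{Y̲_v}` — BY NAME from `SubgraphDecomposition.tri_le_YL` and
`LabelledDecomposition.Pbt_le`.  PROVED. [claim: Mochizuki2012, status: disputed] -/
theorem le_YL_of_cor24_family (hH : Cor24_family Dec Ld H) : H ≤ T.YL := by
  rcases hH with rfl | ⟨I, hI, rfl⟩
  · exact Dec.tri_le_YL
  · exact (Ld.Pbt_le _).trans Dec.tri_le_YL

end Family

section YSplit

variable {W : PlusMinusTower T} {C : CuspidalInertiaData W} {H : Subgroup P}

/-- **IUTchII:Cor2.4(ii)** (a), the **`Y̲_v`-half of sub-node (a.2)** (kurims p. 70 l. 34–42 with Prop. 2.2 p. 66): for an admissible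
`Π_{v□} ⊆ Π^tp_{Y̲_v}`, the decomposition group `D_t = N_{Π_v}(I_t)` of every cuspidal inertia group `I_t ⊆ Δ_{v□}` lies in
`Π^tp_{Y̲_v}` — PROVED modulo exactly the inputs of (a.1): Cor. 2.4 (i) for those `I_t` (node `IUTchII:Cor2.4(i)`), (S)
"`Π^±_{v□} ↠ G_v` relative to `Π_v`" ([IUTchI] Cor. 2.3 (iii)) and (E) "`Π^±_{v□} ∩ Π_v ⊆ Π_{v□}`" (Def. 2.3 (i)/(iv)); argument:
`D_t ⊆ Π_{v□}` (abc-iut-w5-d184's `cuspDecomp_one_le_box_of_cor24_i`) and `Π_{v□} ⊆ Π^tp_{Y̲_v}`. [claim: Mochizuki2012, status: disputed] -/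
theorem cuspDecomp_one_le_map_YL_of_cor24_i
    (h24i : ∀ I : Subgroup W.Corhat, C.IsCuspidalInertia W.piV I → I ≤ W.deltaBox H →
      Literature.IUT.HodgeArakelov.Cor24_i W C H I)
    (hsurj : ∀ n : W.Corhat, n ∈ W.piV → ∃ m : W.Corhat, m ∈ W.pmBox H ∧ m⁻¹ * n ∈ W.aug.ker)
    (hcap : W.pmBox H ⊓ W.piV ≤ W.box H) (hHY : H ≤ T.YL)
    {I : Subgroup W.Corhat} (hI : C.IsCuspidalInertia W.piV I) (hIΔ : I ≤ W.deltaBox H) :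
    W.cuspDecomp I 1 ≤ (T.YL).map (W.emb.comp T.incl) :=
  (cuspDecomp_one_le_box_of_cor24_i h24i hsurj hcap hI hIΔ).trans (Subgroup.map_mono hHY)

/-- **IUTchII:Cor2.4(ii)(iii)′ — ASSEMBLY with the residual in `{±1}`-form** (kurims p. 70): the typed statement of record
`Cor24_ii_iii' W C H` from Cor. 2.4 (i) (cuspidal inertia groups in `Δ_{v□}`), (S), (E), `Π_{v□} ⊆ Π^tp_{Y̲_v}`, and the residual
(YS) "`D_t ∩ Π^tp_{Y̲_v} ⊆ Π^tp_{Ÿ̲_v}`" — the cusps abutting `□` split in `Ÿ̲_v → Y̲_v` (Rmk. 2.1.1 (i); [IUTchI] Ex. 3.2 (ii)) — in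
place of (a.2).  PROVED (modulo the named inputs). [claim: Mochizuki2012, status: disputed] -/
theorem cor24_ii_iii'_of_inputs_of_ysplit
    (h24i : ∀ I : Subgroup W.Corhat, C.IsCuspidalInertia W.piV I → I ≤ W.deltaBox H →
      Literature.IUT.HodgeArakelov.Cor24_i W C H I)
    (hsurj : ∀ n : W.Corhat, n ∈ W.piV → ∃ m : W.Corhat, m ∈ W.pmBox H ∧ m⁻¹ * n ∈ W.aug.ker)
    (hcap : W.pmBox H ⊓ W.piV ≤ W.box H) (hHY : H ≤ T.YL)
    (hsplit : ∀ I : Subgroup W.Corhat, C.IsCuspidalInertia W.piV I → I ≤ W.deltaBox H →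
      W.cuspDecomp I 1 ⊓ (T.YL).map (W.emb.comp T.incl) ≤ (T.YddL).map (W.emb.comp T.incl)) :
    Literature.IUT.HodgeArakelov.Cor24_ii_iii' W C H :=
  cor24_ii_iii'_of_inputs h24i hsurj hcap fun I hI hIΔ =>
    (le_inf le_rfl (cuspDecomp_one_le_map_YL_of_cor24_i h24i hsurj hcap hHY hI hIΔ)).trans (hsplit I hI hIΔ)

variable (W C H) in
/-- **IUTchII:Cor2.4(ii)(iii)′ — EXACTNESS of the sharpened sub-DAG** (kurims p. 70): given Cor. 2.4 (i) for the cuspidal inertia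
groups in `Δ_{v□}`, (S), (E) and `Π_{v□} ⊆ Π^tp_{Y̲_v}`, the typed node statement `Cor24_ii_iii' W C H` is EQUIVALENT to the pure
`{±1}`-residual (YS) "`D_t ∩ Π^tp_{Y̲_v} ⊆ Π^tp_{Ÿ̲_v}` for every cuspidal inertia group `I_t ⊆ Δ_{v□}`".  So, relative to the node
`IUTchII:Cor2.4(i)` and the junction inputs (S), (E), what the node `IUTchII:Cor2.4(ii)` still needs is EXACTLY the splitting of the
cusps abutting `□` in the degree-`2` covering `Ÿ̲_v → Y̲_v`, and nothing about the `l·ℤ`-covering `Y̲_v → X̲_v`.  PROVED.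
[claim: Mochizuki2012, status: disputed] -/
theorem cor24_ii_iii'_iff_ysplit
    (h24i : ∀ I : Subgroup W.Corhat, C.IsCuspidalInertia W.piV I → I ≤ W.deltaBox H →
      Literature.IUT.HodgeArakelov.Cor24_i W C H I)
    (hsurj : ∀ n : W.Corhat, n ∈ W.piV → ∃ m : W.Corhat, m ∈ W.pmBox H ∧ m⁻¹ * n ∈ W.aug.ker)
    (hcap : W.pmBox H ⊓ W.piV ≤ W.box H) (hHY : H ≤ T.YL) :
    Literature.IUT.HodgeArakelov.Cor24_ii_iii' W C H ↔
      ∀ I : Subgroup W.Corhat, C.IsCuspidalInertia W.piV I → I ≤ W.deltaBox H →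
        W.cuspDecomp I 1 ⊓ (T.YL).map (W.emb.comp T.incl) ≤ (T.YddL).map (W.emb.comp T.incl) := by
  constructor
  · intro h I hI hIΔ
    exact inf_le_left.trans (((cor24_ii_iii'_iff_box_and_ydd W C H).mp h).2 I hI hIΔ)
  · exact cor24_ii_iii'_of_inputs_of_ysplit h24i hsurj hcap hHY

end YSplit

section FamilyAssembly

variable {D : EtaleThetaData S.toThetaSetting P} (Dec : SubgraphDecomposition S T D) {W : PlusMinusTower T}
  {C : CuspidalInertiaData W} {L : LabCuspStructure C} (Ld : LabelledDecomposition Dec L) {H : Subgroup P}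

/-- **IUTchII:Cor2.4(ii)(iii)′ for every ADMISSIBLE `Π_{v□}`** (kurims p. 70; `□ ∈ {•t, ▶}`): `Cor24_ii_iii' W C H` from Cor. 2.4 (i)
(cuspidal inertia groups in `Δ_{v□}`), (S), (E) and the `{±1}`-residual (YS); the inclusion `Π_{v□} ⊆ Π^tp_{Y̲_v}` is supplied BY
NAME (`le_YL_of_cor24_family`).  PROVED (modulo the named inputs). [claim: Mochizuki2012, status: disputed] -/
theorem cor24_ii_iii'_of_family_of_ysplit (hH : Cor24_family Dec Ld H)
    (h24i : ∀ I : Subgroup W.Corhat, C.IsCuspidalInertia W.piV I → I ≤ W.deltaBox H →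
      Literature.IUT.HodgeArakelov.Cor24_i W C H I)
    (hsurj : ∀ n : W.Corhat, n ∈ W.piV → ∃ m : W.Corhat, m ∈ W.pmBox H ∧ m⁻¹ * n ∈ W.aug.ker)
    (hcap : W.pmBox H ⊓ W.piV ≤ W.box H)
    (hsplit : ∀ I : Subgroup W.Corhat, C.IsCuspidalInertia W.piV I → I ≤ W.deltaBox H →
      W.cuspDecomp I 1 ⊓ (T.YL).map (W.emb.comp T.incl) ≤ (T.YddL).map (W.emb.comp T.incl)) :
    Literature.IUT.HodgeArakelov.Cor24_ii_iii' W C H :=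
  cor24_ii_iii'_of_inputs_of_ysplit h24i hsurj hcap (le_YL_of_cor24_family Dec Ld hH) hsplit

/-- **The node's residual for an admissible `Π_{v□}`, exactly** (kurims p. 70): under Cor. 2.4 (i), (S), (E) the typed node
statement is EQUIVALENT to the `{±1}`-residual (YS) — family form of `cor24_ii_iii'_iff_ysplit`.  PROVED.
[claim: Mochizuki2012, status: disputed] -/
theorem cor24_ii_iii'_iff_ysplit_of_family (hH : Cor24_family Dec Ld H)
    (h24i : ∀ I : Subgroup W.Corhat, C.IsCuspidalInertia W.piV I → I ≤ W.deltaBox H →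
      Literature.IUT.HodgeArakelov.Cor24_i W C H I)
    (hsurj : ∀ n : W.Corhat, n ∈ W.piV → ∃ m : W.Corhat, m ∈ W.pmBox H ∧ m⁻¹ * n ∈ W.aug.ker)
    (hcap : W.pmBox H ⊓ W.piV ≤ W.box H) :
    Literature.IUT.HodgeArakelov.Cor24_ii_iii' W C H ↔
      ∀ I : Subgroup W.Corhat, C.IsCuspidalInertia W.piV I → I ≤ W.deltaBox H →
        W.cuspDecomp I 1 ⊓ (T.YL).map (W.emb.comp T.incl) ≤ (T.YddL).map (W.emb.comp T.incl) :=
  cor24_ii_iii'_iff_ysplit W C H h24i hsurj hcap (le_YL_of_cor24_family Dec Ld hH)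

end FamilyAssembly

end Literature.IUT.HodgeArakelov
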